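import Summits.ResolutionOfSingularities.ResolutionOfSingularities.Theorems.WeightedInvariantPartialChart
import Summits.ResolutionOfSingularities.ResolutionOfSingularities.Theorems.WeightedInvariantHypersurfaceLocalGameEFTDimTwoNewton
import HarnessLib

/-!
# The P3a cylinder move: regular parameters `(t⁻¹, z, W, …)` of the successor rings on the tie curve (ORDER (o36))

Topic: `Summits/ResolutionOfSingularities/ResolutionOfSingularities/Theorems`. Helper for the door item
`HypersurfaceCentreConstruction` (statement `stmt-ResolutionOfSingularities-19897`, route `WeightedInvariant`), line
`local-engine` of `res-L1-w43-plan-1`, IOTA3-DESIGN v1.3 §8.4 regime CURVE° (RULING gen 11 #2), ORDER (o36) held by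
res-type-092 (design memo `plan/tools/res-type-092/o36/O36-DESIGN.md` §6 «type (b)»; kernel plan v2, FILE B).

SETTING. `S` regular local, `(y, x, z)` a regular system of parameters (`spanFinrank 𝔪 = 3`), `P = (y, x)` PRIME, weights
`w` positive on `(y, x)`; `B = S[t⁻¹, 𝒥ₙ((y,x); w) tⁿ]` (the cylinder over `V(P)`), with its two charts: the exceptional chart
`ρ : B ↠ (S ⧸ P)[X₀, X₁]` (`ker ρ = (t⁻¹)`, res-type-092 `LocalGameEFTPointMove.exists_rhoPartial`) and the special-fibre
chart `ρ₀ : B ↠ κ[X₀, X₁]` (`ker ρ₀ = (t⁻¹, z)`, sibling `…P3aSpecialFibre`); both enter as HYPOTHESIS BUNDLES, so this file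
is independent of how they are constructed.  Let `W ∈ B` reduce to a COORDINATE-LIKE form `ρ₀(W) = Xᵢ - μ·Xⱼ^r` (`i ≠ j`;
the tie curve `C₀ = {Ȳ' = 0}` of the memo: `W = (y - λ̃ x^r) t^{w₀}`), and let `𝔫 ⊇ (t⁻¹, z, W)` be ANY prime of `B`.

MAIN RESULT (`exists_rsp_of_mem`): `B_𝔫` is a REGULAR local ring of dimension `k ∈ {3, 4}` with a regular system of
parameters `v = (t⁻¹, z, W)` (the generic point of `C₀`) or `v = (t⁻¹, z, W, p̃)` (a closed point; `p̃` lifts an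
irreducible polynomial of `κ[Xⱼ] ≅ κ[X₀, X₁]/(ρ₀ W)`): `𝔫 = (v)`, `ringKrullDim B_𝔫 = k`, `(v/1) = 𝔪_{B_𝔫}`.  Proof: the
chain of primes `(t⁻¹) ⊂ (t⁻¹, z) ⊂ (t⁻¹, z, W) ⊂ 𝔫` (kernels of `ρ`, `ρ₀`, `φ ∘ ρ₀` for the substitution
`φ : κ[X₀,X₁] ↠ κ[X]`, `Xᵢ ↦ μX^r`, `Xⱼ ↦ X`, `ker φ = (Xᵢ - μXⱼ^r)` — `exists_killVar`) gives `height 𝔫 ≥ k`, the `k`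
generators give `spanFinrank 𝔪_{B_𝔫} ≤ k`, and Krull (`ringKrullDim ≤ spanFinrank`, Mathlib) closes the sandwich
(`isRegularLocalRing_of_primeChain`, pure commutative algebra).  Consumed by `…P3aTieFreeDrop`: K5
(`LocalGameEFTNewton.le_weight_of_mem_weightedMonomialIdeal`) in `B_𝔫` along `v`.

Def-free (all maps by `∃`).  [OURS · L1 W4.3] Replaces the role of NO printed item; NOT a statement of the manuscript under
review [claim: Hironaka2017, status: under-review].  AI work, weaker than expert review.

## References

* J. Włodarczyk, *Functorial resolution by torus actions*, arXiv:2203.03090, §2.3.9 (the exceptional divisor of the full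
  cobordant blow-up is the weighted normal bundle; regularity of `B`). [Wlodarczyk2022]
* H. Matsumura, *Commutative Ring Theory*, Thm. 13.4 (Krull: `dim ≤ μ(𝔪)`), Thm. 14.2. [Matsumura1987]
-/

noncomputable section

open IsLocalRing Literature.AlgebraicGeometry.Resolution

set_option linter.dupNamespace false -- mandated namespace of this single-conjunct summit

namespace Summit.ResolutionOfSingularities.ResolutionOfSingularities.Theorems

namespace LocalGameEFTCylinder

/-! ### §1 Killing a coordinate-like polynomial: `κ[X₀, X₁]/(Xᵢ - μXⱼ^r) ≅ κ[X]` -/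

section KillVar

variable {κ : Type} [CommRing κ]

/-- **The substitution `Xᵢ ↦ μ X^r`, `Xⱼ ↦ X`** (`i ≠ j` in `Fin 2`): a SURJECTIVE ring map `φ : κ[X₀, X₁] ↠ κ[X]` with
`φ(Xⱼ) = X`, `φ(Xᵢ) = μX^r`, `φ(C a) = C a`, and KERNEL `(Xᵢ - μ Xⱼ^r)`. [folklore] -/
theorem exists_killVar (i j : Fin 2) (hij : i ≠ j) (μ : κ) (r : ℕ) :
    ∃ φ : MvPolynomial (Fin 2) κ →+* Polynomial κ, Function.Surjective φ ∧
      RingHom.ker φ = Ideal.span {MvPolynomial.X i - MvPolynomial.C μ * MvPolynomial.X j ^ r} ∧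
      φ (MvPolynomial.X j) = Polynomial.X ∧ φ (MvPolynomial.X i) = Polynomial.C μ * Polynomial.X ^ r ∧
      ∀ a : κ, φ (MvPolynomial.C a) = Polynomial.C a := by
  classical
  set v : Fin 2 → Polynomial κ := fun k => if k = j then Polynomial.X else Polynomial.C μ * Polynomial.X ^ r with hv
  set φ : MvPolynomial (Fin 2) κ →ₐ[κ] Polynomial κ := MvPolynomial.aeval v with hφ
  set ψ : Polynomial κ →ₐ[κ] MvPolynomial (Fin 2) κ := Polynomial.aeval (MvPolynomial.X j) with hψ
  have hφj : φ (MvPolynomial.X j) = Polynomial.X := by rw [hφ, MvPolynomial.aeval_X, hv]; simp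
  have hφi : φ (MvPolynomial.X i) = Polynomial.C μ * Polynomial.X ^ r := by
    rw [hφ, MvPolynomial.aeval_X, hv]; simp [hij]
  have hφC : ∀ a : κ, φ (MvPolynomial.C a) = Polynomial.C a := fun a => by
    rw [hφ, MvPolynomial.algHom_C]; rfl
  have hsect : ∀ p : Polynomial κ, φ (ψ p) = p := by
    intro p
    have h : (φ.comp ψ) = AlgHom.id κ (Polynomial κ) := by
      refine Polynomial.algHom_ext ?_
      rw [AlgHom.comp_apply, hψ, Polynomial.aeval_X, hφj, AlgHom.id_apply]
    exact congrArg (fun g : Polynomial κ →ₐ[κ] Polynomial κ => g p) h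
  set I : Ideal (MvPolynomial (Fin 2) κ) :=
    Ideal.span {MvPolynomial.X i - MvPolynomial.C μ * MvPolynomial.X j ^ r} with hI
  -- every polynomial is congruent mod `I` to the re-embedding of its image
  have hkey : ∀ p : MvPolynomial (Fin 2) κ, p - ψ (φ p) ∈ I := by
    intro p
    induction p using MvPolynomial.induction_on with
    | C a =>
      rw [hφC, hψ, Polynomial.aeval_C, MvPolynomial.algebraMap_eq, sub_self]
      exact I.zero_mem
    | add p q hp hq =>
      rw [map_add, map_add, add_sub_add_comm]
      exact I.add_mem hp hq
    | mul_X p k hp =>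
      rw [map_mul, map_mul]
      have hk : MvPolynomial.X k - ψ (φ (MvPolynomial.X k)) ∈ I := by
        by_cases hkj : k = j
        · subst hkj
          rw [hφj, hψ, Polynomial.aeval_X, sub_self]
          exact I.zero_mem
        · have hki : k = i := by
            rcases Fin.exists_fin_two.mp ⟨k, rfl⟩ with h0 | h1 <;>
            rcases Fin.exists_fin_two.mp ⟨i, rfl⟩ with hi0 | hi1 <;>
            rcases Fin.exists_fin_two.mp ⟨j, rfl⟩ with hj0 | hj1 <;> simp_all
          subst hki
          rw [hφi, hψ, map_mul, map_pow, Polynomial.aeval_C, Polynomial.aeval_X, MvPolynomial.algebraMap_eq]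
          exact Ideal.subset_span (Set.mem_singleton _)
      have h1 : p * MvPolynomial.X k - ψ (φ p) * ψ (φ (MvPolynomial.X k)) =
          (p - ψ (φ p)) * MvPolynomial.X k + ψ (φ p) * (MvPolynomial.X k - ψ (φ (MvPolynomial.X k))) := by ring
      rw [h1]
      exact I.add_mem (I.mul_mem_right _ hp) (I.mul_mem_left _ hk)
  refine ⟨φ.toRingHom, fun p => ⟨ψ p, hsect p⟩, ?_, hφj, hφi, hφC⟩
  apply le_antisymm
  · intro p hp
    rw [RingHom.mem_ker] at hp
    have h := hkey p
    rwa [show φ p = 0 from hp, map_zero, sub_zero] at h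
  · rw [hI, Ideal.span_le, Set.singleton_subset_iff, SetLike.mem_coe, RingHom.mem_ker]
    change φ (MvPolynomial.X i - MvPolynomial.C μ * MvPolynomial.X j ^ r) = 0
    rw [map_sub, map_mul, map_pow, hφi, hφj, hφC, sub_self]

/-- The primes of `κ[X]` (`κ` a field) are principal: `Q = (p)`; `p = 0` or not decides generic/closed. [folklore] -/
theorem exists_eq_span_singleton_of_polynomial {κ : Type} [Field κ] (Q : Ideal (Polynomial κ)) :
    ∃ p : Polynomial κ, Q = Ideal.span {p} :=
  ⟨Submodule.IsPrincipal.generator Q, (Ideal.span_singleton_generator Q).symm⟩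

end KillVar

/-! ### §2 Regularity from a chain of primes and a short generating set -/

section Chain

variable {B : Type} [CommRing B] [IsNoetherianRing B]

omit [IsNoetherianRing B] in
/-- Heights along a strict chain of primes grow by at least one at each step. [cite: Matsumura1987, §5] -/
theorem le_height_of_chain {k : ℕ} (c : Fin (k + 1) → Ideal B) (hc : ∀ i, (c i).IsPrime)
    (hlt : ∀ i : Fin k, c i.castSucc < c i.succ) (i : Fin (k + 1)) : ((i : ℕ) : ℕ∞) ≤ (c i).height := by
  induction i using Fin.induction with
  | zero => simp
  | succ i ih =>
    haveI := hc i.castSucc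
    haveI := hc i.succ
    have h := Ideal.height_add_one_le_of_lt_of_isPrime (hlt i)
    calc ((i.succ : ℕ) : ℕ∞) = (i : ℕ) + 1 := by simp
      _ ≤ (c i.castSucc).height + 1 := add_le_add ih le_rfl
      _ ≤ (c i.succ).height := h

/-- **Regular with the given parameters.**  `B` Noetherian, `𝔫 = (v₀, …, v_{k-1})` a prime at the top of a strict chain
of `k + 1` primes: then `B_𝔫` is a regular local ring of Krull dimension `k` and `(v/1)` is a regular system of
parameters (`(v/1) = 𝔪_{B_𝔫}`).  (Krull: `dim ≤ μ(𝔪)`.) [cite: Matsumura1987, Thm. 13.4] -/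
theorem isRegularLocalRing_of_primeChain {k : ℕ} (𝔫 : Ideal B) [𝔫.IsPrime] (v : Fin k → B)
    (hv : Ideal.span (Set.range v) = 𝔫) (c : Fin (k + 1) → Ideal B) (hc : ∀ i, (c i).IsPrime)
    (hlt : ∀ i : Fin k, c i.castSucc < c i.succ) (hlast : c (Fin.last k) = 𝔫) :
    IsRegularLocalRing (Localization.AtPrime 𝔫) ∧ ringKrullDim (Localization.AtPrime 𝔫) = k ∧
      Ideal.span (Set.range fun i => algebraMap B (Localization.AtPrime 𝔫) (v i)) =
        maximalIdeal (Localization.AtPrime 𝔫) := by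
  haveI : IsNoetherianRing (Localization.AtPrime 𝔫) :=
    IsLocalization.isNoetherianRing 𝔫.primeCompl (Localization.AtPrime 𝔫) inferInstance
  -- height from the chain
  have hheight : ((k : ℕ) : ℕ∞) ≤ 𝔫.height := by
    have h := le_height_of_chain c hc hlt (Fin.last k)
    rwa [hlast, Fin.val_last] at h
  -- the generators of `𝔪`
  have hspan : Ideal.span (Set.range fun i => algebraMap B (Localization.AtPrime 𝔫) (v i)) =
      maximalIdeal (Localization.AtPrime 𝔫) := by
    have h1 : maximalIdeal (Localization.AtPrime 𝔫) = (Ideal.span (Set.range v)).map (algebraMap B _) := by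
      rw [hv]; exact Localization.AtPrime.map_eq_maximalIdeal.symm
    rw [h1, Ideal.map_span, ← Set.range_comp]
    rfl
  have hfin : (maximalIdeal (Localization.AtPrime 𝔫)).spanFinrank ≤ k := by
    rw [← hspan]
    refine (Submodule.spanFinrank_span_le_ncard_of_finite (Set.finite_range _)).trans ?_
    rw [← Set.image_univ]
    refine (Set.ncard_image_le Set.finite_univ).trans ?_
    rw [Set.ncard_univ, Nat.card_eq_fintype_card, Fintype.card_fin]
  have hdim : ringKrullDim (Localization.AtPrime 𝔫) = 𝔫.height :=
    IsLocalization.AtPrime.ringKrullDim_eq_height 𝔫 (Localization.AtPrime 𝔫)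
  have hge : ((k : ℕ∞) : WithBot ℕ∞) ≤ ringKrullDim (Localization.AtPrime 𝔫) := by
    rw [hdim]; exact_mod_cast hheight
  have hle : ringKrullDim (Localization.AtPrime 𝔫) ≤ ((maximalIdeal (Localization.AtPrime 𝔫)).spanFinrank : WithBot ℕ∞) :=
    ringKrullDim_le_spanFinrank_maximalIdeal _
  have hfin' : (((maximalIdeal (Localization.AtPrime 𝔫)).spanFinrank : ℕ∞) : WithBot ℕ∞) ≤ (k : ℕ∞) := by
    exact_mod_cast hfin
  have hdimk : ringKrullDim (Localization.AtPrime 𝔫) = k := le_antisymm (hle.trans hfin') hge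
  refine ⟨IsRegularLocalRing.of_spanFinrank_maximalIdeal_le _ (hfin'.trans hge), hdimk, hspan⟩

end Chain

/-! ### §3 The successor rings of the cylinder on the tie curve -/

section Cylinder

variable {S : Type} [CommRing S] {y x z : S} {w : Fin 2 → ℕ}

/-- Kernel bookkeeping: for a surjection `ρ` with `ker ρ ≤ 𝔫`, `𝔫 = ρ⁻¹(ρ 𝔫)`. [folklore] -/
theorem eq_comap_map {B P : Type} [CommRing B] [CommRing P] (ρ : B →+* P) (hρ : Function.Surjective ρ)
    (𝔫 : Ideal B) (hker : RingHom.ker ρ ≤ 𝔫) : 𝔫 = (𝔫.map ρ).comap ρ := by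
  rw [Ideal.comap_map_of_surjective' _ hρ]
  exact (sup_eq_left.mpr hker).symm

/-- The preimage of a span under a surjection with a spanned kernel is the span of lifts and kernel generators.
[folklore] -/
theorem comap_span_eq_of_surjective {B P : Type} [CommRing B] [CommRing P] (ρ : B →+* P)
    (hρ : Function.Surjective ρ) {K : Set B} (hker : RingHom.ker ρ = Ideal.span K) {T : Set P} {L : Set B}
    (hL : ρ '' L = T) : (Ideal.span T).comap ρ = Ideal.span (K ∪ L) := by
  have h1 : Ideal.span T = (Ideal.span L).map ρ := by rw [Ideal.map_span, hL]
  rw [h1, Ideal.comap_map_of_surjective' _ hρ, hker, Ideal.span_union, sup_comm]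

/-- `Xᵢ - μ Xⱼ^r ≠ 0` for `i ≠ j` (its `Xᵢ`-coefficient is `1`). [folklore] -/
theorem X_sub_C_mul_X_pow_ne_zero {κ : Type} [CommRing κ] [Nontrivial κ] {i j : Fin 2} (hij : i ≠ j) (μ : κ) (r : ℕ) :
    (MvPolynomial.X i - MvPolynomial.C μ * MvPolynomial.X j ^ r : MvPolynomial (Fin 2) κ) ≠ 0 := by
  classical
  intro h0
  have h2 := congrArg (MvPolynomial.coeff (Finsupp.single i 1)) h0
  rw [MvPolynomial.coeff_sub, MvPolynomial.coeff_zero, MvPolynomial.coeff_C_mul, MvPolynomial.X_pow_eq_monomial,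
    MvPolynomial.coeff_monomial, if_neg, mul_zero, sub_zero, MvPolynomial.coeff_X, if_pos rfl] at h2
  · exact one_ne_zero h2
  · intro heq
    have h3 := congrArg (fun f : Fin 2 →₀ ℕ => f i) heq
    simp only [Finsupp.single_apply, hij.symm, if_false, if_true] at h3
    exact zero_ne_one h3

/-- **Regular parameters `(T, z, W[, p̃])` from two charts — abstract form.**  `B` a Noetherian domain, `ρ : B → A`
(`A` a domain) with `ker ρ = (T)`, `T ≠ 0`, `ρ z ≠ 0`; `ρ₀ : B ↠ κ[X₀, X₁]` (`κ` a field) with `ker ρ₀ = (T, z)`;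
`W ∈ B` with `ρ₀ W = Xᵢ - μXⱼ^r` (`i ≠ j`).  Then every prime `𝔫 ∋ T, z, W` is `(T, z, W)` or `(T, z, W, p̃)`, and `B_𝔫`
is regular local of dimension `3` resp. `4` with these as a regular system of parameters.
[cite: Matsumura1987, Thm. 13.4] -/
theorem exists_rsp_of_mem_of_charts {B : Type} [CommRing B] [IsDomain B] [IsNoetherianRing B] {A : Type}
    [CommRing A] [IsDomain A] (ρ : B →+* A) {T zB W : B} (hT0 : T ≠ 0) (hρker : RingHom.ker ρ = Ideal.span {T})
    (hρz : ρ zB ≠ 0) {κ : Type} [Field κ] (ρ₀ : B →+* MvPolynomial (Fin 2) κ) (hρ₀s : Function.Surjective ρ₀)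
    (hρ₀ker : RingHom.ker ρ₀ = Ideal.span {T, zB}) {i j : Fin 2} (hij : i ≠ j) {μ : κ} {r : ℕ}
    (hW : ρ₀ W = MvPolynomial.X i - MvPolynomial.C μ * MvPolynomial.X j ^ r) (𝔫 : Ideal B) [𝔫.IsPrime]
    (hT : T ∈ 𝔫) (hz : zB ∈ 𝔫) (hW𝔫 : W ∈ 𝔫) :
    ∃ (k : ℕ) (v : Fin k → B) (h0 : 0 < k) (h1 : 1 < k) (h2 : 2 < k),
      k ≤ 4 ∧ v ⟨0, h0⟩ = T ∧ v ⟨1, h1⟩ = zB ∧ v ⟨2, h2⟩ = W ∧ Ideal.span (Set.range v) = 𝔫 ∧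
      IsRegularLocalRing (Localization.AtPrime 𝔫) ∧ ringKrullDim (Localization.AtPrime 𝔫) = k ∧
      Ideal.span (Set.range fun l => algebraMap B (Localization.AtPrime 𝔫) (v l)) =
        maximalIdeal (Localization.AtPrime 𝔫) := by
  classical
  obtain ⟨φ, hφs, hφker, hφj, hφi, hφC⟩ := exists_killVar (κ := κ) i j hij μ r
  -- the third kernel
  have hker3 : RingHom.ker (φ.comp ρ₀) = Ideal.span {T, zB, W} := by
    have h1 : RingHom.ker (φ.comp ρ₀) = (RingHom.ker φ).comap ρ₀ := by
      ext b; simp [RingHom.mem_ker]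
    rw [h1, hφker, comap_span_eq_of_surjective ρ₀ hρ₀s hρ₀ker (L := {W}) (by rw [Set.image_singleton, hW])]
    congr 1
    ext b
    simp only [Set.mem_union, Set.mem_insert_iff, Set.mem_singleton_iff]
    tauto
  -- primality of the kernels
  have hp1 : (Ideal.span ({T} : Set B)).IsPrime := by rw [← hρker]; exact RingHom.ker_isPrime ρ
  have hp2 : (Ideal.span ({T, zB} : Set B)).IsPrime := by rw [← hρ₀ker]; exact RingHom.ker_isPrime ρ₀
  have hp3 : (Ideal.span ({T, zB, W} : Set B)).IsPrime := by rw [← hker3]; exact RingHom.ker_isPrime _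
  -- strictness of the chain
  have hbot : (⊥ : Ideal B) < Ideal.span {T} := by
    refine bot_lt_iff_ne_bot.mpr fun h => hT0 ?_
    have hmem : T ∈ (⊥ : Ideal B) := by rw [← h]; exact Ideal.subset_span (Set.mem_singleton _)
    exact (Submodule.mem_bot B).mp hmem
  have hlt12 : Ideal.span ({T} : Set B) < Ideal.span {T, zB} := by
    refine lt_of_le_of_ne (Ideal.span_mono (by simp)) fun h => hρz ?_
    have hmem : zB ∈ Ideal.span ({T} : Set B) := by rw [h]; exact Ideal.subset_span (by simp)
    rw [← hρker] at hmem
    exact hmem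
  have hlt23 : Ideal.span ({T, zB} : Set B) < Ideal.span {T, zB, W} := by
    refine lt_of_le_of_ne (Ideal.span_mono fun b hb => ?_) fun h => X_sub_C_mul_X_pow_ne_zero hij μ r ?_
    · simp only [Set.mem_insert_iff, Set.mem_singleton_iff] at hb ⊢; tauto
    · have hmem : W ∈ Ideal.span ({T, zB} : Set B) := by rw [h]; exact Ideal.subset_span (by simp)
      rw [← hρ₀ker, RingHom.mem_ker, hW] at hmem
      exact hmem
  have hker3le : RingHom.ker (φ.comp ρ₀) ≤ 𝔫 := by
    rw [hker3, Ideal.span_le]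
    intro b hb
    simp only [Set.mem_insert_iff, Set.mem_singleton_iff] at hb
    rcases hb with rfl | rfl | rfl
    · exact hT
    · exact hz
    · exact hW𝔫
  -- the image of `𝔫` in `κ[X]` is principal
  have hφρs : Function.Surjective (φ.comp ρ₀) := hφs.comp hρ₀s
  obtain ⟨p, hp⟩ := exists_eq_span_singleton_of_polynomial (𝔫.map (φ.comp ρ₀))
  obtain ⟨Pt, hPt⟩ := hφρs p
  have h𝔫eq : 𝔫 = Ideal.span ({T, zB, W} ∪ {Pt}) := by
    rw [eq_comap_map (φ.comp ρ₀) hφρs 𝔫 hker3le, hp]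
    exact comap_span_eq_of_surjective (φ.comp ρ₀) hφρs hker3 (L := {Pt}) (by rw [Set.image_singleton, hPt])
  by_cases hp0 : p = 0
  · -- generic point of the tie curve: `𝔫 = (T, z, W)`, `k = 3`
    have hPt0 : Pt ∈ Ideal.span ({T, zB, W} : Set B) := by
      rw [← hker3, RingHom.mem_ker, hPt, hp0]
    have h𝔫3 : 𝔫 = Ideal.span {T, zB, W} := by
      rw [h𝔫eq]
      apply le_antisymm
      · rw [Ideal.span_le]
        rintro b (hb | hb)
        · exact Ideal.subset_span hb
        · rw [Set.mem_singleton_iff] at hb; rw [hb]; exact hPt0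
      · exact Ideal.span_mono Set.subset_union_left
    have hvr : Set.range ![T, zB, W] = {T, zB, W} := by
      rw [Matrix.range_cons, Matrix.range_cons_cons_empty, Set.singleton_union]
    obtain ⟨hreg, hdim, hsp⟩ := isRegularLocalRing_of_primeChain 𝔫 ![T, zB, W] (by rw [hvr, h𝔫3])
      ![⊥, Ideal.span {T}, Ideal.span {T, zB}, Ideal.span {T, zB, W}]
      (fun l => by
        fin_cases l
        · exact Ideal.isPrime_bot
        · exact hp1
        · exact hp2
        · exact hp3)
      (fun l => by
        fin_cases l
        · exact hbot
        · exact hlt12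
        · exact hlt23)
      (by rw [h𝔫3]; rfl)
    exact ⟨3, ![T, zB, W], by omega, by omega, by omega, by omega, rfl, rfl, rfl, by rw [hvr, h𝔫3], hreg, hdim,
      hsp⟩
  · -- closed point: `𝔫 = (T, z, W, p̃)`, `k = 4`
    have hlt34 : Ideal.span ({T, zB, W} : Set B) < 𝔫 := by
      refine lt_of_le_of_ne (by rw [← hker3]; exact hker3le) fun h => hp0 ?_
      have hmap : 𝔫.map (φ.comp ρ₀) = ⊥ := by
        rw [← h, ← hker3, Ideal.map_eq_bot_iff_le_ker]
      rw [hp, Ideal.span_singleton_eq_bot] at hmap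
      exact hmap
    have hvr : Set.range ![T, zB, W, Pt] = {T, zB, W} ∪ {Pt} := by
      rw [Matrix.range_cons, Matrix.range_cons, Matrix.range_cons_cons_empty]
      ext b
      simp only [Set.mem_union, Set.mem_insert_iff, Set.mem_singleton_iff, Set.singleton_union]
      tauto
    obtain ⟨hreg, hdim, hsp⟩ := isRegularLocalRing_of_primeChain 𝔫 ![T, zB, W, Pt] (by rw [hvr, h𝔫eq])
      ![⊥, Ideal.span {T}, Ideal.span {T, zB}, Ideal.span {T, zB, W}, 𝔫]
      (fun l => by
        fin_cases l
        · exact Ideal.isPrime_bot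
        · exact hp1
        · exact hp2
        · exact hp3
        · exact ‹𝔫.IsPrime›)
      (fun l => by
        fin_cases l
        · exact hbot
        · exact hlt12
        · exact hlt23
        · exact hlt34)
      rfl
    exact ⟨4, ![T, zB, W, Pt], by omega, by omega, by omega, le_rfl, rfl, rfl, rfl, by rw [hvr, h𝔫eq], hreg, hdim,
      hsp⟩

variable [IsRegularLocalRing S]

/-- **The successor rings of the cylinder on the tie curve are regular with parameters `(t⁻¹, z, W[, p̃])`.**
`S` regular local, `P = (y, x)` prime with `z ∉ P`; `ρ : B ↠ (S⧸P)[X₀,X₁]` with `ker ρ = (t⁻¹)` and `ρ(a) = ā`,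
`ρ₀ : B ↠ κ[X₀,X₁]` (`κ` a field) with `ker ρ₀ = (t⁻¹, z)`; `W ∈ B` with `ρ₀ W = Xᵢ - μ Xⱼ^r` (`i ≠ j`).  Then for every
prime `𝔫 ∋ t⁻¹, z, W` of `B` there are `k ∈ {3, 4}` and `v : Fin k → B` with `v₀ = t⁻¹`, `v₁ = z`, `v₂ = W`,
`(v) = 𝔫`, `B_𝔫` regular local of dimension `k` and `(v/1) = 𝔪_{B_𝔫}`. [cite: Wlodarczyk2022, §2.3.9] -/
theorem exists_rsp_of_mem [hP : (Ideal.span (Set.range ![y, x])).IsPrime] (hzP : z ∉ Ideal.span (Set.range ![y, x]))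
    {ρ : extReesAlgebra (weightedMonomialIdeal ![y, x] w) →+*
      MvPolynomial (Fin 2) (S ⧸ Ideal.span (Set.range ![y, x]))}
    (hρker : RingHom.ker ρ = Ideal.span {extReesAlgebra.tInv (weightedMonomialIdeal ![y, x] w)})
    (hρC : ∀ a : S, ρ (algebraMap S _ a) = MvPolynomial.C (Ideal.Quotient.mk _ a))
    {κ : Type} [Field κ] {ρ₀ : extReesAlgebra (weightedMonomialIdeal ![y, x] w) →+* MvPolynomial (Fin 2) κ}
    (hρ₀s : Function.Surjective ρ₀)
    (hρ₀ker : RingHom.ker ρ₀ = Ideal.span {extReesAlgebra.tInv (weightedMonomialIdeal ![y, x] w),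
      algebraMap S _ z})
    {W : extReesAlgebra (weightedMonomialIdeal ![y, x] w)} {i j : Fin 2} (hij : i ≠ j) {μ : κ} {r : ℕ}
    (hW : ρ₀ W = MvPolynomial.X i - MvPolynomial.C μ * MvPolynomial.X j ^ r)
    (𝔫 : Ideal (extReesAlgebra (weightedMonomialIdeal ![y, x] w))) [𝔫.IsPrime]
    (hT : extReesAlgebra.tInv (weightedMonomialIdeal ![y, x] w) ∈ 𝔫) (hz : algebraMap S _ z ∈ 𝔫) (hW𝔫 : W ∈ 𝔫) :
    ∃ (k : ℕ) (v : Fin k → extReesAlgebra (weightedMonomialIdeal ![y, x] w)) (h0 : 0 < k) (h1 : 1 < k) (h2 : 2 < k),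
      k ≤ 4 ∧ v ⟨0, h0⟩ = extReesAlgebra.tInv (weightedMonomialIdeal ![y, x] w) ∧ v ⟨1, h1⟩ = algebraMap S _ z ∧
      v ⟨2, h2⟩ = W ∧ Ideal.span (Set.range v) = 𝔫 ∧
      IsRegularLocalRing (Localization.AtPrime 𝔫) ∧ ringKrullDim (Localization.AtPrime 𝔫) = k ∧
      Ideal.span (Set.range fun l => algebraMap _ (Localization.AtPrime 𝔫) (v l)) =
        maximalIdeal (Localization.AtPrime 𝔫) := by
  haveI := isDomain_of_isRegularLocalRing S
  haveI : IsNoetherianRing (extReesAlgebra (weightedMonomialIdeal ![y, x] w)) :=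
    isNoetherianRing_extReesAlgebra (stub_extReesAlgebra_weighted ![y, x] w)
  haveI : IsDomain (S ⧸ Ideal.span (Set.range ![y, x])) := (Ideal.Quotient.isDomain_iff_prime _).mpr hP
  have hT0 : extReesAlgebra.tInv (weightedMonomialIdeal ![y, x] w) ≠ 0 :=
    nonZeroDivisors.ne_zero (tInv_mem_nonZeroDivisors (weightedMonomialIdeal ![y, x] w))
  have hρz : ρ (algebraMap S _ z) ≠ 0 := by
    rw [hρC, Ne, MvPolynomial.C_eq_zero, Ideal.Quotient.eq_zero_iff_mem]
    exact hzP
  exact exists_rsp_of_mem_of_charts ρ hT0 hρker hρz ρ₀ hρ₀s hρ₀ker hij hW 𝔫 hT hz hW𝔫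

end Cylinder

end LocalGameEFTCylinder

end Summit.ResolutionOfSingularities.ResolutionOfSingularities.Theorems

end
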